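import Summits.Ventures.PercRepro.S1CoreCapAvg
import Summits.Ventures.PercRepro.S1CoreCapSpecFourMain

/-!
# PercRepro — THE 4-CIRCUIT BOUNDS MODULO THE ONE COMPUTED INSTANCE `Q*(5) = 11` (p1, gen 23; the s₄ seat)

`proofs/P1-S4-CAPBRIDGE.md` §12–§13. The instances `ν ≤ 4` of the 4-circuit-cap spec are kernel theorems
(`fourCapSpec_zero / _one / _two` in `S1CoreCapSpec`, `fourCapSpec_three` in `S1CoreCapSpecThree`,
`fourCapSpec_four` in `S1CoreCapSpecFourMain`), so every bound of `S1CoreCapSum` / `S1CoreCapAvg` that was stated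
modulo the three computed instances `Q*(3) = 5`, `Q*(4) = 8`, `Q*(5) = 11` now rests on the single computed Prop
`FourCapSpec capPaper 5 11` (three implementations: fourcap.py, fourcap.c, fourcap_brute.py; kit j239700). The
statements below are the same theorems with the two proved hypotheses discharged; nothing else changes.
Axioms: standard.
-/

open scoped Matroid

namespace PercRepro

namespace S1

open Set

open FourCap

variable {α : Type}

/-- The instances `j ≤ 5` of the spec from the single computed instance `Q*(5) = 11`. -/
theorem fourCapSpec_qStar_le_five_of_five (hQ5 : FourCapSpec capPaper 5 11) :
    ∀ j ≤ 5, FourCapSpec capPaper j (qStar j) :=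
  fourCapSpec_qStar_le_five fourCapSpec_three fourCapSpec_four hQ5

/-- The instances `j ≤ 6` of the spec from the two computed instances `Q*(5) = 11` and `Q*(6) = 16` (for the older
`∀ j ≤ 6` form of p2's row-12 glue). -/
theorem fourCapSpec_qStar_le_six_of_five_six (hQ5 : FourCapSpec capPaper 5 11)
    (hQ6 : FourCapSpec capPaper 6 16) : ∀ j ≤ 6, FourCapSpec capPaper j (qStar j) := by
  intro j hj
  rcases Nat.lt_or_ge j 6 with h | h
  · exact fourCapSpec_qStar_le_five_of_five hQ5 j (by omega)
  · have hj6 : j = 6 := by omega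
    subst hj6
    exact hQ6

/-- **`s₄ ≤ 29` on every core of nullity 5** — modulo `Q*(5) = 11` alone. -/
theorem ncard_fourCircuits_le_twenty_nine_of_five (M : Matroid α) [M.Finite]
    (hfree : ∀ e ∈ M.E, ∃ A ⊆ M.E \ {e}, e ∉ M.closure A ∧ e ∉ M.closure ((M.E \ {e}) \ A))
    (hd : M.E.encard = M.eRank + 5) (hQ5 : FourCapSpec capPaper 5 11) :
    {C : Set α | M.IsCircuit C ∧ C.ncard = 4}.ncard ≤ 29 :=
  ncard_fourCircuits_le_twenty_nine M hfree hd fourCapSpec_three fourCapSpec_four hQ5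

/-- **`s₄ ≤ 59` on every core of nullity 6** (the star step) — modulo `Q*(5) = 11` alone. -/
theorem ncard_fourCircuits_le_fifty_nine_of_five (M : Matroid α) [M.Finite]
    (hfree : ∀ e ∈ M.E, ∃ A ⊆ M.E \ {e}, e ∉ M.closure A ∧ e ∉ M.closure ((M.E \ {e}) \ A))
    (hd : M.E.encard = M.eRank + 6) (hQ5 : FourCapSpec capPaper 5 11) :
    {C : Set α | M.IsCircuit C ∧ C.ncard = 4}.ncard ≤ 59 :=
  ncard_fourCircuits_le_fifty_nine M hfree hd fourCapSpec_three fourCapSpec_four hQ5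

/-- **`s₄ ≤ 49` on every core of nullity 6** — modulo `Q*(5) = 11` alone (the cell `(12,6)`). -/
theorem ncard_fourCircuits_le_forty_nine_of_five (M : Matroid α) [M.Finite]
    (hfree : ∀ e ∈ M.E, ∃ A ⊆ M.E \ {e}, e ∉ M.closure A ∧ e ∉ M.closure ((M.E \ {e}) \ A))
    (hd : M.E.encard = M.eRank + 6) (hQ5 : FourCapSpec capPaper 5 11) :
    {C : Set α | M.IsCircuit C ∧ C.ncard = 4}.ncard ≤ 49 :=
  ncard_fourCircuits_le_forty_nine M hfree hd fourCapSpec_three fourCapSpec_four hQ5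

/-- **`s₄ ≤ 79` on every core of nullity 7** (two star steps) — modulo `Q*(5) = 11` alone. -/
theorem ncard_fourCircuits_le_seventy_nine_of_five (M : Matroid α) [M.Finite]
    (hfree : ∀ e ∈ M.E, ∃ A ⊆ M.E \ {e}, e ∉ M.closure A ∧ e ∉ M.closure ((M.E \ {e}) \ A))
    (hd : M.E.encard = M.eRank + 7) (hQ5 : FourCapSpec capPaper 5 11) :
    {C : Set α | M.IsCircuit C ∧ C.ncard = 4}.ncard ≤ 79 :=
  ncard_fourCircuits_le_seventy_nine M hfree hd fourCapSpec_three fourCapSpec_four hQ5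

/-- **`s₄ ≤ 73` on every core of nullity 7** (the averaging recursion) — modulo `Q*(5) = 11` alone (the cell
`(11,7)`). -/
theorem ncard_fourCircuits_le_seventy_three_of_five (M : Matroid α) [M.Finite]
    (hfree : ∀ e ∈ M.E, ∃ A ⊆ M.E \ {e}, e ∉ M.closure A ∧ e ∉ M.closure ((M.E \ {e}) \ A))
    (hd : M.E.encard = M.eRank + 7) (hQ5 : FourCapSpec capPaper 5 11) :
    {C : Set α | M.IsCircuit C ∧ C.ncard = 4}.ncard ≤ 73 :=
  ncard_fourCircuits_le_seventy_three M hfree hd fourCapSpec_three fourCapSpec_four hQ5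

/-- **`s₄ ≤ 105` on every core of nullity 8** — modulo `Q*(5) = 11` alone (the cell `(11,8)`). -/
theorem ncard_fourCircuits_le_one_hundred_five_of_five (M : Matroid α) [M.Finite]
    (hfree : ∀ e ∈ M.E, ∃ A ⊆ M.E \ {e}, e ∉ M.closure A ∧ e ∉ M.closure ((M.E \ {e}) \ A))
    (hd : M.E.encard = M.eRank + 8) (hQ5 : FourCapSpec capPaper 5 11) :
    {C : Set α | M.IsCircuit C ∧ C.ncard = 4}.ncard ≤ 105 :=
  ncard_fourCircuits_le_one_hundred_five M hfree hd fourCapSpec_three fourCapSpec_four hQ5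

/-- **`s₄ ≤ 147` on every core of nullity 9** — modulo `Q*(5) = 11` alone. -/
theorem ncard_fourCircuits_le_one_hundred_forty_seven_of_five (M : Matroid α) [M.Finite]
    (hfree : ∀ e ∈ M.E, ∃ A ⊆ M.E \ {e}, e ∉ M.closure A ∧ e ∉ M.closure ((M.E \ {e}) \ A))
    (hd : M.E.encard = M.eRank + 9) (hQ5 : FourCapSpec capPaper 5 11) :
    {C : Set α | M.IsCircuit C ∧ C.ncard = 4}.ncard ≤ 147 :=
  ncard_fourCircuits_le_one_hundred_forty_seven M hfree hd fourCapSpec_three fourCapSpec_four hQ5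

/-- **`s₄ ≤ avgBound k` on every core of nullity `k + 6`** — modulo `Q*(5) = 11` alone. -/
theorem ncard_fourCircuits_le_avgBound_of_five (k : ℕ) (M : Matroid α) [M.Finite]
    (hfree : ∀ e ∈ M.E, ∃ A ⊆ M.E \ {e}, e ∉ M.closure A ∧ e ∉ M.closure ((M.E \ {e}) \ A))
    (hd : M.E.encard = M.eRank + (k + 6)) (hQ5 : FourCapSpec capPaper 5 11) :
    {C : Set α | M.IsCircuit C ∧ C.ncard = 4}.ncard ≤ avgBound k :=
  ncard_fourCircuits_le_avgBound k M hfree hd fourCapSpec_three fourCapSpec_four hQ5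

end S1

end PercRepro
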